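import Mathlib.Data.Real.Basic
import Mathlib.Tactic
import HarnessLib

/-!
# `NoHeavyLowerTail` (stmt-CriticalPhenomena-4575) — the TORUS IDENTITY behind the 2+2 kernel (pure real algebra)

Support file (lead seat `prim-nh-lead-4575` gen 9; `--supports stmt-CriticalPhenomena-4575`).  No definitions, no named facts, no sorries.

In the two-lonely-children kernel with two 2-port pendant stars (lead memo KERNEL-BETA-R-TORUS.md; prim-lf-3 LF3-BETA-R.md)
the (41)-margin of the glued block is MULTI-AFFINE in the four hair weights, while the split-argmin hypothesis sees the two hairs
`h₁, h₂` of a star only through the bridge probability `u = h₁ h₂`.  For the bi-affine interpolation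
`F(s,t) = (1−s)(1−t)F₀₀ + s(1−t)F₁₀ + (1−s)tF₀₁ + stF₁₁` of four corner values and `u = h₁h₂` one has the IDENTITY
  `(1 − u)·F(h₁,h₂) = (h₁ − u)·F(1,u) + (h₂ − u)·F(u,1) + (1 − h₁)(1 − h₂)·[(1 − u)F(0,0) + uF(1,1)]`
with the three coefficients nonnegative on `[0,1]²` — the torus point is a convex combination of the two SURE-HAIR corners
`F(1,u)`, `F(u,1)` and the 'both-or-neither' formal unit `(1−u)F₀₀ + uF₁₁`.  Applied in each star this writes the kernel margin
as a nonnegative combination of nine corner values (eight proved by glue transfer / KN Lemma 4, the ninth by prim-lf-3's anchored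
exchange), which is how the 2+2 cell is assembled.  Below `F(s,t)` is always written out.

* `KernelTorus.torus_identity` — the identity (by `ring`).
* `KernelTorus.biAffine_nonneg_of_corners` — `F(1,u), F(u,1), (1−u)F₀₀+uF₁₁ ≥ 0`, `0 ≤ hᵢ ≤ 1` imply `F(h₁,h₂) ≥ 0` (the case
  `u = 1` forces `h₁ = h₂ = 1`).
-/

namespace Summit.CriticalPhenomena.PercolationContinuityZ3.Theorems

noncomputable section

namespace KernelTorus

/-- **Torus identity**: with `F(s,t) := (1−s)(1−t)F₀₀ + s(1−t)F₁₀ + (1−s)tF₀₁ + stF₁₁` and `u = h₁h₂`,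
`(1−u)·F(h₁,h₂) = (h₁−u)·F(1,u) + (h₂−u)·F(u,1) + (1−h₁)(1−h₂)·[(1−u)F₀₀ + uF₁₁]`. [folklore] -/
theorem torus_identity (F₀₀ F₁₀ F₀₁ F₁₁ h₁ h₂ : ℝ) :
    (1 - h₁ * h₂) * ((1 - h₁) * (1 - h₂) * F₀₀ + h₁ * (1 - h₂) * F₁₀ + (1 - h₁) * h₂ * F₀₁ + h₁ * h₂ * F₁₁) =
      (h₁ - h₁ * h₂) * ((1 - h₁ * h₂) * F₁₀ + (h₁ * h₂) * F₁₁) +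
      (h₂ - h₁ * h₂) * ((1 - h₁ * h₂) * F₀₁ + (h₁ * h₂) * F₁₁) +
      (1 - h₁) * (1 - h₂) * ((1 - h₁ * h₂) * F₀₀ + (h₁ * h₂) * F₁₁) := by
  ring

/-- **Corners imply the torus.**  With `F` as above and `u = h₁h₂`: `F(1,u) = (1−u)F₁₀ + uF₁₁`, `F(u,1) = (1−u)F₀₁ + uF₁₁` and the
formal-unit value `(1−u)F₀₀ + uF₁₁`; if these three are `≥ 0` and `0 ≤ h₁, h₂ ≤ 1` then `F(h₁,h₂) ≥ 0`. [folklore] -/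
theorem biAffine_nonneg_of_corners (F₀₀ F₁₀ F₀₁ F₁₁ h₁ h₂ : ℝ)
    (h₁0 : 0 ≤ h₁) (h₁1 : h₁ ≤ 1) (h₂0 : 0 ≤ h₂) (h₂1 : h₂ ≤ 1)
    (c1 : 0 ≤ (1 - h₁ * h₂) * F₁₀ + (h₁ * h₂) * F₁₁)
    (c2 : 0 ≤ (1 - h₁ * h₂) * F₀₁ + (h₁ * h₂) * F₁₁)
    (c0 : 0 ≤ (1 - h₁ * h₂) * F₀₀ + (h₁ * h₂) * F₁₁) :
    0 ≤ (1 - h₁) * (1 - h₂) * F₀₀ + h₁ * (1 - h₂) * F₁₀ + (1 - h₁) * h₂ * F₀₁ + h₁ * h₂ * F₁₁ := by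
  have hid := torus_identity F₀₀ F₁₀ F₀₁ F₁₁ h₁ h₂
  have l1 : 0 ≤ h₁ - h₁ * h₂ := by nlinarith
  have l2 : 0 ≤ h₂ - h₁ * h₂ := by nlinarith
  have l0 : 0 ≤ (1 - h₁) * (1 - h₂) := mul_nonneg (by linarith) (by linarith)
  have hrhs : 0 ≤ (1 - h₁ * h₂) *
      ((1 - h₁) * (1 - h₂) * F₀₀ + h₁ * (1 - h₂) * F₁₀ + (1 - h₁) * h₂ * F₀₁ + h₁ * h₂ * F₁₁) := by
    rw [hid]
    have t1 := mul_nonneg l1 c1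
    have t2 := mul_nonneg l2 c2
    have t0 := mul_nonneg l0 c0
    linarith
  by_cases hu : h₁ * h₂ < 1
  · have hpos : 0 < 1 - h₁ * h₂ := by linarith
    by_contra hneg
    push Not at hneg
    have := mul_neg_of_pos_of_neg hpos hneg
    linarith
  · -- u = 1 forces h₁ = h₂ = 1, and then the value is F₁₁ = F(1,u) ≥ 0
    have hu1 : h₁ * h₂ = 1 := le_antisymm (by nlinarith) (by linarith)
    have e1 : h₁ = 1 := by nlinarith
    have e2 : h₂ = 1 := by nlinarith
    subst e1; subst e2
    norm_num at c1 ⊢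
    exact c1

end KernelTorus

end

end Summit.CriticalPhenomena.PercolationContinuityZ3.Theorems
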